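import Literature.MathematicalPhysics.KineticTheory.CollisionTubePullbackFlight
import Literature.MathematicalPhysics.KineticTheory.CollisionTubeWeightOscillation
import HarnessLib

/-!
# Comparison of collision sums along a hard-sphere orbit: linearity and domination in the mark, the velocity cut

Topic `Literature/MathematicalPhysics/KineticTheory` (proof item; wanted by the crux line `Sketch` of
`InformationPercolationEngine.PercolationClosesChaos`, stmt-AtomisticToContinuum-14915, helper stub
`stub_pullbackInProb`; companion of `CollisionTubePullbackVelocityCut`).  Elementary bookkeeping of the
collision sum `K_N[χ g Ξ] = collisionSum …` (`EvenCollisionTubeFunctional`) along ONE good hard-sphere orbit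
(finitely many collisions in `[0, τ]`, GST 2013 §4.1), needed to read Boltzmann's collision-cylinder argument
(CIP 1994 §2.2) under a law that controls only unweighted collision moments:

* the continuous VELOCITY CUT `cut_L(v, v') = (min(L − max(‖v‖, ‖v'‖), 1))₊ ∈ [0, 1]`: it vanishes for relative
  speed `≥ 2L` (`velCut_eq_zero_of_le`), is non-zero only for speeds `< L` (`max_norm_lt_of_velCut_ne_zero`),
  and its complement is dominated by the FAST-PAIR MARK `f_V = (min(max(‖v‖,‖v'‖) − V, 1))₊` for `V + 1 ≤ L`
  (`one_sub_velCut_le_fastMark`);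
* post- versus pre-collisional speeds: `‖v‖ + ‖w‖ ≤ 2(‖v⁻‖ + ‖w⁻‖)` (`norm_add_norm_le_two_mul_reflectVel`);
* `collisionSum_sub_mark` (linearity in the mark), `abs_collisionSum_le_of_abs_le`
  (`|K_N[χ g Ξ]| ≤ C_χ C_g C_Ξ K_N[1·1·f]` when `|Ξ| ≤ C_Ξ f`), `shortFlightDeficit_le_of_abs_le`
  (`R_short[Ψ] ≤ C R_short[1]`), `collisionSum_one_eq` (`K_N[1]` is `ε/(N+1)` times the collision count).

## References

* C. Cercignani, R. Illner, M. Pulvirenti, *The Mathematical Theory of Dilute Gases* (1994), §2.2,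
  App. 4.A. [CIPDiluteGases1994]
* I. Gallagher, L. Saint-Raymond, B. Texier, *From Newton to Boltzmann* (2013), Part II Ch. 4, §4.1
  (Prop. 4.1.1, Def. 4.1.2). [GallagherSaintRaymondTexier2013]
-/

noncomputable section

open MeasureTheory Set Filter Topology
open scoped ENNReal InnerProductSpace BigOperators

namespace Literature.MathematicalPhysics.KineticTheory

open _root_.MeasureTheory Literature.Analysis.FluidPDE

/-! ### The velocity cut and the fast-pair mark -/

/-- The continuous velocity cut `cut_L(n, v, v') = (min(L − max(‖v‖, ‖v'‖), 1))₊ ∈ [0, 1]`: `= 1` when both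
speeds are `≤ L − 1`, `= 0` when one is `≥ L`. [folklore] -/
theorem velCut_mem_Icc (L : ℝ) (q : V3 × V3 × V3) :
    max (min (L - max ‖q.2.1‖ ‖q.2.2‖) 1) 0 ∈ Icc (0 : ℝ) 1 :=
  ⟨le_max_right _ _, max_le (min_le_right _ _) zero_le_one⟩

/-- The velocity cut vanishes on pairs of relative speed `≥ 2L`. [folklore] -/
theorem velCut_eq_zero_of_le {L : ℝ} {q : V3 × V3 × V3} (h : 2 * L ≤ ‖q.2.2 - q.2.1‖) :
    max (min (L - max ‖q.2.1‖ ‖q.2.2‖) 1) 0 = 0 := by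
  have h1 : ‖q.2.2 - q.2.1‖ ≤ ‖q.2.2‖ + ‖q.2.1‖ := norm_sub_le _ _
  have h2 : ‖q.2.1‖ ≤ max ‖q.2.1‖ ‖q.2.2‖ := le_max_left _ _
  have h3 : ‖q.2.2‖ ≤ max ‖q.2.1‖ ‖q.2.2‖ := le_max_right _ _
  refine max_eq_right ((min_le_left _ _).trans ?_)
  linarith

/-- Off the support of the fast-pair complement: if the cut is non-zero then both speeds are `< L`. [folklore] -/
theorem max_norm_lt_of_velCut_ne_zero {L : ℝ} {q : V3 × V3 × V3}
    (h : max (min (L - max ‖q.2.1‖ ‖q.2.2‖) 1) 0 ≠ 0) : max ‖q.2.1‖ ‖q.2.2‖ < L := by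
  by_contra hle
  push Not at hle
  exact h (max_eq_right ((min_le_left _ _).trans (by linarith)))

/-- The complement of the velocity cut is dominated by the fast-pair mark at any level `V ≤ L − 1`:
`1 − cut_L ≤ f_V = (min(max(‖v‖,‖v'‖) − V, 1))₊`. [folklore] -/
theorem one_sub_velCut_le_fastMark {L V : ℝ} (hVL : V + 1 ≤ L) (q : V3 × V3 × V3) :
    1 - max (min (L - max ‖q.2.1‖ ‖q.2.2‖) 1) 0 ≤ max (min (max ‖q.2.1‖ ‖q.2.2‖ - V) 1) 0 := by
  set m := max ‖q.2.1‖ ‖q.2.2‖ with hm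
  rcases le_or_gt m (L - 1) with h1 | h1
  · rw [min_eq_right (by linarith : (1 : ℝ) ≤ L - m), max_eq_left zero_le_one, sub_self]
    exact le_max_right _ _
  rcases le_or_gt L m with h2 | h2
  · have : max (min (L - m) 1) 0 = 0 := max_eq_right ((min_le_left _ _).trans (by linarith))
    rw [this, sub_zero]
    have : min (m - V) 1 = 1 := min_eq_right (by linarith)
    rw [this, max_eq_left zero_le_one]
  · rw [min_eq_left (by linarith : L - m ≤ 1), max_eq_left (by linarith : (0 : ℝ) ≤ L - m)]
    refine le_trans ?_ (le_max_left _ _)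
    exact le_min (by linarith) (by linarith)

/-- The velocity cut is continuous. [folklore] -/
theorem continuous_velCut (L : ℝ) : Continuous fun q : V3 × V3 × V3 => max (min (L - max ‖q.2.1‖ ‖q.2.2‖) 1) 0 := by
  fun_prop

/-- The second pre-collisional velocity has norm at most `‖v‖ + ‖w‖`. [folklore] -/
theorem norm_reflectVel_snd_le (n : V3) (p : V3 × V3) : ‖(reflectVel n p).2‖ ≤ ‖p.1‖ + ‖p.2‖ := by
  have h := norm_sq_reflectVel_fst_add_norm_sq_reflectVel_snd n p
  have h1 : ‖(reflectVel n p).2‖ ^ 2 ≤ (‖p.1‖ + ‖p.2‖) ^ 2 := by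
    nlinarith [sq_nonneg ‖(reflectVel n p).1‖, norm_nonneg p.1, norm_nonneg p.2]
  exact (pow_le_pow_iff_left₀ (norm_nonneg _) (by positivity) two_ne_zero).1 h1

/-- The post-collisional speeds are controlled by the pre-collisional ones:
`‖v‖ + ‖w‖ ≤ 2 (‖v⁻‖ + ‖w⁻‖)`, `(v⁻, w⁻) = reflectVel n (v, w)` (the reflection is an involution). [folklore] -/
theorem norm_add_norm_le_two_mul_reflectVel (n : V3) (p : V3 × V3) :
    ‖p.1‖ + ‖p.2‖ ≤ 2 * (‖(reflectVel n p).1‖ + ‖(reflectVel n p).2‖) := by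
  have h1 := norm_reflectVel_fst_le n (reflectVel n p)
  have h2 := norm_reflectVel_snd_le n (reflectVel n p)
  rw [reflectVel_reflectVel] at h1 h2
  linarith

/-! ### Comparison of collision sums along a good orbit -/

section Compare

variable {σ : ℝ} {N : ℕ} {Φ : HardSphereFlow (Torus.geometry (Fin 3)) (hsDiameter σ N) (N + 1)}
  {z : Config (N + 1) (Fin 3) T3} {τ : ℝ}

/-- The unit weight: `weightAt σ N 1 1 ρ t ζ i = 1`. [folklore] -/
@[simp]
theorem weightAt_one_one (ρ t : ℝ) (ζ : Config (N + 1) (Fin 3) T3) (i : Fin (N + 1)) :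
    weightAt σ N (fun _ => (1 : ℝ)) (fun _ => (1 : ℝ)) ρ t ζ i = 1 := by
  simp [weightAt]

/-- The unit mark: `collMark σ N 1 ζ i j = 1`. [folklore] -/
@[simp]
theorem collMark_one (ζ : Config (N + 1) (Fin 3) T3) (i j : Fin (N + 1)) :
    collMark σ N (fun _ => (1 : ℝ)) ζ i j = 1 := by
  simp [collMark]

/-- **The collision sum is linear in the mark** along a good orbit:
`K_N[χ g Ξ₁] − K_N[χ g Ξ₂] = K_N[χ g (Ξ₁ − Ξ₂)]`. [folklore] -/
theorem collisionSum_sub_mark (hz : z ∈ Φ.good) (χ : ℝ × UnitAddTorus (Fin 3) → ℝ) (g : ℝ → ℝ)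
    (Ξ₁ Ξ₂ : V3 × V3 × V3 → ℝ) (ρ : ℝ) :
    Literature.MathematicalPhysics.KineticTheory.collisionSum σ N Φ τ χ g Ξ₁ ρ z -
        Literature.MathematicalPhysics.KineticTheory.collisionSum σ N Φ τ χ g Ξ₂ ρ z =
      Literature.MathematicalPhysics.KineticTheory.collisionSum σ N Φ τ χ g (Ξ₁ - Ξ₂) ρ z := by
  have hfin : (collisionTimes (Torus.geometry (Fin 3)) (hsDiameter σ N) (orbit σ N Φ z) ∩ Icc 0 τ).Finite :=
    (isTraj hz).locFinite 0 τ
  rw [collisionSum_eq_collisionPairSum σ N χ g Ξ₁ ρ Φ τ z (orbit_mem hz),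
    collisionSum_eq_collisionPairSum σ N χ g Ξ₂ ρ Φ τ z (orbit_mem hz),
    collisionSum_eq_collisionPairSum σ N χ g (Ξ₁ - Ξ₂) ρ Φ τ z (orbit_mem hz), ← mul_sub]
  congr 1
  rw [sub_eq_iff_eq_add, ← collisionPairSum_add hfin]
  refine congrArg _ (funext fun s => funext fun i => funext fun j => ?_)
  simp only [collMark, Pi.sub_apply]
  ring

/-- **Domination of a collision sum by an unweighted one.**  If `|χ| ≤ C_χ` on `[0, τ] × 𝕋³`, `|g| ≤ C_g`
on `[0, ∞)` and `|Ξ| ≤ C_Ξ f` pointwise, then `|K_N[χ g Ξ]| ≤ C_χ C_g C_Ξ K_N[1 · 1 · f]` along a good orbit.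
[folklore] -/
theorem abs_collisionSum_le_of_abs_le (hz : z ∈ Φ.good) (hσ : 0 ≤ σ) {χ : ℝ × UnitAddTorus (Fin 3) → ℝ}
    {g : ℝ → ℝ} {Ξ f : V3 × V3 × V3 → ℝ} {ρ Cχ Cg CΞ : ℝ} (hρ : 0 < ρ)
    (hχb : ∀ t ∈ Icc (0 : ℝ) τ, ∀ x, |χ (t, x)| ≤ Cχ) (hgb : ∀ a, 0 ≤ a → |g a| ≤ Cg)
    (hΞ : ∀ q, |Ξ q| ≤ CΞ * f q) (ρ' : ℝ) :
    |Literature.MathematicalPhysics.KineticTheory.collisionSum σ N Φ τ χ g Ξ ρ z| ≤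
      Cχ * Cg * CΞ * Literature.MathematicalPhysics.KineticTheory.collisionSum σ N Φ τ
        (fun _ => 1) (fun _ => 1) f ρ' z := by
  have hfin : (collisionTimes (Torus.geometry (Fin 3)) (hsDiameter σ N) (orbit σ N Φ z) ∩ Icc 0 τ).Finite :=
    (isTraj hz).locFinite 0 τ
  have hε0 : 0 ≤ hsDiameter σ N := by
    unfold hsDiameter; exact mul_nonneg hσ (Real.rpow_nonneg (by positivity) _)
  have hc : 0 ≤ hsDiameter σ N / (N + 1 : ℝ) := by positivity
  rw [collisionSum_eq_collisionPairSum σ N χ g Ξ ρ Φ τ z (orbit_mem hz),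
    collisionSum_eq_collisionPairSum σ N (fun _ => 1) (fun _ => 1) f ρ' Φ τ z (orbit_mem hz), abs_mul,
    abs_of_nonneg hc, mul_left_comm, ← collisionPairSum_const_mul hfin]
  -- pointwise domination of the summand
  have hpt : ∀ s ∈ collisionTimes (Torus.geometry (Fin 3)) (hsDiameter σ N) (orbit σ N Φ z) ∩ Icc 0 τ,
      ∀ p ∈ contactPairs (Torus.geometry (Fin 3)) (hsDiameter σ N) (orbit σ N Φ z s),
      |weightAt σ N χ g ρ s (orbit σ N Φ z s) p.1 * collMark σ N Ξ (orbit σ N Φ z s) p.1 p.2| ≤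
        Cχ * Cg * CΞ * (weightAt σ N (fun _ => (1 : ℝ)) (fun _ => (1 : ℝ)) ρ' s (orbit σ N Φ z s) p.1 *
          collMark σ N f (orbit σ N Φ z s) p.1 p.2) := by
    intro s hs p _
    rw [weightAt_one_one, one_mul]
    have hw := abs_weightAt_le hχb hgb hσ hρ hs.2 (orbit σ N Φ z s) p.1
    have hm := hΞ ((hsDiameter σ N)⁻¹ • sepAt (orbit σ N Φ z s) p.1 p.2,
      (reflectVel (sepAt (orbit σ N Φ z s) p.1 p.2) ((orbit σ N Φ z s p.1).2, (orbit σ N Φ z s p.2).2)).1,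
      (reflectVel (sepAt (orbit σ N Φ z s) p.1 p.2) ((orbit σ N Φ z s p.1).2, (orbit σ N Φ z s p.2).2)).2)
    change |collMark σ N Ξ (orbit σ N Φ z s) p.1 p.2| ≤ CΞ * collMark σ N f (orbit σ N Φ z s) p.1 p.2 at hm
    rw [abs_mul, mul_assoc (Cχ * Cg)]
    exact mul_le_mul hw hm (abs_nonneg _) ((abs_nonneg _).trans hw)
  refine mul_le_mul_of_nonneg_left (abs_le.2 ⟨?_, ?_⟩) hc
  · have h := collisionPairSum_mono hfin (g := fun s i j => (-1 : ℝ) * (Cχ * Cg * CΞ *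
        (weightAt σ N (fun _ => (1 : ℝ)) (fun _ => (1 : ℝ)) ρ' s (orbit σ N Φ z s) i * collMark σ N f (orbit σ N Φ z s) i j)))
      (g' := fun s i j => weightAt σ N χ g ρ s (orbit σ N Φ z s) i * collMark σ N Ξ (orbit σ N Φ z s) i j)
      fun s hs p hp => by have := abs_le.1 (hpt s hs p hp); linarith [this.1]
    rw [collisionPairSum_const_mul hfin] at h
    linarith
  · exact collisionPairSum_mono hfin fun s hs p hp => (abs_le.1 (hpt s hs p hp)).2

/-- **The short-flight deficit is monotone in the mark**: `|Ψ| ≤ C` gives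
`R_short[Ψ] ≤ C · R_short[1]` along a good orbit. [folklore] -/
theorem shortFlightDeficit_le_of_abs_le (hz : z ∈ Φ.good) {Ψ : V3 × V3 × V3 → ℝ} {C : ℝ}
    (hΨ : ∀ q, |Ψ q| ≤ C) (κ : ℝ) :
    shortFlightDeficit σ N Φ τ Ψ κ z ≤ C * shortFlightDeficit σ N Φ τ (fun _ => 1) κ z := by
  have hfin : (collisionTimes (Torus.geometry (Fin 3)) (hsDiameter σ N) (orbit σ N Φ z) ∩ Icc 0 τ).Finite :=
    (isTraj hz).locFinite 0 τ
  unfold shortFlightDeficit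
  rw [← collisionPairSum_const_mul hfin]
  refine collisionPairSum_mono hfin fun s _ p _ => ?_
  simp only [collMark_one, abs_one, one_mul]
  exact mul_le_mul_of_nonneg_right (hΨ _) (le_max_right _ _)

/-- **The normalised collision count is `K_N[1]`**: along a good orbit
`K_N[1 · 1 · 1] = ε/(N+1) · Σ_{collisions ≤ τ, ordered contact pairs} 1`. [folklore] -/
theorem collisionSum_one_eq (hz : z ∈ Φ.good) (ρ : ℝ) :
    Literature.MathematicalPhysics.KineticTheory.collisionSum σ N Φ τ (fun _ => 1) (fun _ => 1) (fun _ => 1) ρ z =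
      hsDiameter σ N / (N + 1 : ℝ) *
        collisionPairSum (Torus.geometry (Fin 3)) (hsDiameter σ N) (orbit σ N Φ z) (Icc 0 τ) (fun _ _ _ => (1 : ℝ)) := by
  rw [collisionSum_eq_collisionPairSum σ N (fun _ => 1) (fun _ => 1) (fun _ => 1) ρ Φ τ z (orbit_mem hz)]
  simp only [weightAt_one_one, collMark_one, mul_one]

end Compare

end Literature.MathematicalPhysics.KineticTheory

end
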